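import Summits.AtomisticToContinuum.FouriersLaw.Theorems.JunctionLocalityNonBallisticDrudeLineDefs
import Summits.AtomisticToContinuum.FouriersLaw.Theorems.BondHeatUncertaintyLinearResponseFTURLineComposition
import Summits.AtomisticToContinuum.FouriersLaw.Theorems.BondHeatUncertaintyLinearResponseFTUREntropyBalance
import Summits.AtomisticToContinuum.FouriersLaw.Theorems.BondHeatUncertaintyLinearResponseFTURPathLebesgueDuality
import Summits.AtomisticToContinuum.FouriersLaw.Theorems.BondHeatUncertaintyLinearResponseFTURK3Final
import Summits.AtomisticToContinuum.FouriersLaw.Theorems.BondHeatUncertaintyLinearResponseFTURSteadyHeatRates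
import Summits.AtomisticToContinuum.FouriersLaw.Theorems.BondHeatUncertaintyLinearResponseFTURNessFacts
import Summits.AtomisticToContinuum.FouriersLaw.Theorems.BondHeatUncertaintyLinearResponseFTUREquilibriumBondHeatVariance
import Literature.Probability.Entropy.FluctuationTheoremUncertainty

/-!
# Stub `stub_totalCurrentFTURTransfer` of line `drude-controls-conductance` (R1) — crux `JunctionLocality.NonBallistic`
(stmt-AtomisticToContinuum-9127)

The lever's TRANSFER statement (= `DrudeLine.TotalCurrentFTURTransfer`): the four fixed-`N` parts
`TimeIntegratedCurrentMean`, `EquilibriumTimeIntegratedCurrentVariance`, `TimeIntegratedCurrentVarianceContinuity`,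
`TotalHeatPathwiseIdentity` imply the planner's `TotalCurrentFTUR` verbatim.

Proof (the pattern is `LinearResponseFTUR.Line.transfer`, clause (b), of the closed twin crux ★): at each small
`δ ≠ 0` instantiate the vendored Hasegawa–Van Vu FTUR (`Literature.Probability.Entropy.HasegawaVanVu2019_FTUR_holds`)
on the endpoint–heat space `Obs N` with `P := fluxLaw … i0 iN i0 (T ± δ/2) t μ_δ`, `ι := flipObs N` and the ODD
observable `φ := totalHeatObs … N i0` (`totalHeatObs_flipObs`); the probability / absolute-continuity / `llr`
inputs and the value `⟨Σ_t⟩ = KL(μ_δ‖Θ_*μ_δ) - E[Q_L]/(T+δ/2) - E[Q_R]/(T-δ/2)` come from the landed entropy balance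
`LinearResponseFTUR.stub_entropyBalance (gdb_of_duality_and_girsanov stub_pathLebesgueDuality stub_antiDampedGirsanov)`,
the heats `E[Q_L] = tJ_δ = -E[Q_R]`, `J_δ = totalCurrent(μ_δ)/(N-1)`, from `LinearResponseFTUR.stub_steadyHeatRates`.
Mean, square-integrability and variance of `φ` under `P` are TRANSPORTED to the time-integrated total current
`Φ_t` under `μ_δ ⊗ W` along the measurable raw-observable map (`fluxLaw_eq`,
`EquilibriumBondHeatVariance.measurable_rawObs_fwdPath`, the pathwise identity `φ ∘ Ψ = Φ_t` = part 4, Mathlib's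
`integral_map` / `memLp_map_measure_iff` / `variance_map`), where parts 1–3 and `ness_eq_gibbsMeasure` give
`E Φ_t = t · totalCurrent(μ_δ)`, eventual `L²`, and `Var_δ(Φ_t) → 2∫₀ᵗ(t-s)C_N(s)ds`. The bookkeeping certificate
`LinearResponseFTUR.Line.shape_of_hvv_family` is fed with the `(N-1)`-RESCALED family `m δ = tJ_δ`,
`v δ = Var_δ(Φ_t)/(N-1)²`, `G = D_N/(N-1)`, `V = 2∫₀ᵗ(t-s)C_N(s)ds/(N-1)²` (the entropy factor carries the per-bond
current, the mean the total one), and the conclusion is multiplied back by `(N-1)²`.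
-/

noncomputable section

namespace Summit.AtomisticToContinuum.FouriersLaw.Theorems.NonBallistic

open MeasureTheory ProbabilityTheory Filter Topology
open scoped NNReal ENNReal BigOperators
open Literature.MathematicalPhysics.KineticTheory
open Literature.MathematicalPhysics.KineticTheory.HeatConduction
open Literature.Probability.Process
open Summit.AtomisticToContinuum.FouriersLaw.Theorems.BondHeatUncertainty
open Summit.AtomisticToContinuum.FouriersLaw.Theorems.JunctionLocality
open Summit.AtomisticToContinuum.FouriersLaw.Theorems.NonBallistic.DrudeLine

/-- **Transport along the raw-observable map.** For the pinned chain (`ω₂ > 0`, `lam, β, γ ≥ 0`), `N ≥ 2`, bath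
sites `i0 = 0`, `iN = N - 1` (bond slot `i0`), any temperatures, `t ≥ 0` and any initial law `μ`: given the
pathwise identity `TotalHeatPathwiseIdentity` (`totalHeatObs ∘ Ψ = Φ_t` pointwise), the mean, the square
integrability and the variance of `totalHeatObs` under the flux law `fluxLaw … μ = (μ ⊗ W).map Ψ` are those of the
time-integrated total current `Φ_t` under `μ ⊗ W` (`integral_map`, `memLp_map_measure_iff`, `variance_map`; `Ψ` is
measurable by `EquilibriumBondHeatVariance.measurable_rawObs_fwdPath`, `totalHeatObs` by `measurable_totalHeatObs`). -/
private theorem transport {ω₂ lam β γ : ℝ} (hω : 0 < ω₂) (hl : 0 ≤ lam) (hβ : 0 ≤ β) (hγ : 0 ≤ γ)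
    (hP : TotalHeatPathwiseIdentity) (N : ℕ) (i0 iN : Fin N) (hN : 2 ≤ N) (hi0 : i0.val = 0)
    (hiN : iN.val = N - 1) (T_L T_R t : ℝ) (ht : 0 ≤ t) (μ : Measure (PhaseSpace N)) :
    (∫ p, totalHeatObs (pinnedChain ω₂ lam β γ) N i0 p
        ∂(fluxLaw (pinnedChain ω₂ lam β γ) N i0 iN i0 T_L T_R t μ) =
      ∫ zw, timeIntegratedCurrent (pinnedChain ω₂ lam β γ) N T_L T_R t zw ∂(μ.prod wienerPair)) ∧
    (MemLp (totalHeatObs (pinnedChain ω₂ lam β γ) N i0) 2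
        (fluxLaw (pinnedChain ω₂ lam β γ) N i0 iN i0 T_L T_R t μ) ↔
      MemLp (timeIntegratedCurrent (pinnedChain ω₂ lam β γ) N T_L T_R t) 2 (μ.prod wienerPair)) ∧
    variance (totalHeatObs (pinnedChain ω₂ lam β γ) N i0)
        (fluxLaw (pinnedChain ω₂ lam β γ) N i0 iN i0 T_L T_R t μ) =
      variance (timeIntegratedCurrent (pinnedChain ω₂ lam β γ) N T_L T_R t) (μ.prod wienerPair) := by
  have hΨ : Measurable fun zw : PhaseSpace N × WienerPair =>
      rawObs (pinnedChain ω₂ lam β γ) N i0 iN i0 t zw.1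
        (fwdPath (pinnedChain ω₂ lam β γ) N T_L T_R zw.1 zw.2) :=
    LinearResponseFTUR.EquilibriumBondHeatVariance.measurable_rawObs_fwdPath hω hl hβ hγ N T_L T_R i0 iN i0 t
  have hφ : Measurable (totalHeatObs (pinnedChain ω₂ lam β γ) N i0) :=
    measurable_totalHeatObs _ (pinnedChain_contDiff_U ω₂ lam β γ (n := 0)).continuous
      (pinnedChain_contDiff_V ω₂ lam β γ (n := 0)).continuous N i0
  have hcomp : (totalHeatObs (pinnedChain ω₂ lam β γ) N i0 ∘ fun zw : PhaseSpace N × WienerPair =>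
      rawObs (pinnedChain ω₂ lam β γ) N i0 iN i0 t zw.1
        (fwdPath (pinnedChain ω₂ lam β γ) N T_L T_R zw.1 zw.2)) =
      timeIntegratedCurrent (pinnedChain ω₂ lam β γ) N T_L T_R t := by
    funext zw
    exact hP ω₂ lam β γ hω hl hβ hγ N i0 iN i0 hN hi0 hiN T_L T_R t ht zw.1 zw.2
  rw [fluxLaw_eq]
  refine ⟨?_, ?_, ?_⟩
  · rw [integral_map hΨ.aemeasurable hφ.aestronglyMeasurable]
    exact integral_congr_ae (Eventually.of_forall fun zw =>
      hP ω₂ lam β γ hω hl hβ hγ N i0 iN i0 hN hi0 hiN T_L T_R t ht zw.1 zw.2)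
  · rw [memLp_map_measure_iff hφ.aestronglyMeasurable hΨ.aemeasurable, hcomp]
  · rw [variance_map hφ.aemeasurable hΨ.aemeasurable, hcomp]

/-- Undoing the `(N-1)` rescaling: `2 (D/A)² t² ≤ (X/A²) · Y` with `A ≠ 0` gives `2 D² t² ≤ X · Y`. -/
private theorem rescale_back {A D t X Y : ℝ} (hA : A ≠ 0)
    (h : 2 * (D / A) ^ 2 * t ^ 2 ≤ X / A ^ 2 * Y) : 2 * D ^ 2 * t ^ 2 ≤ X * Y := by
  have hA2 : (0 : ℝ) < A ^ 2 := by positivity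
  have h' := mul_le_mul_of_nonneg_right h hA2.le
  have e1 : 2 * (D / A) ^ 2 * t ^ 2 * A ^ 2 = 2 * D ^ 2 * t ^ 2 := by
    field_simp
  have e2 : X / A ^ 2 * Y * A ^ 2 = X * Y := by
    field_simp
  linarith [h', e1, e2]

/-- **Stub `stub_totalCurrentFTURTransfer`** (= `DrudeLine.TotalCurrentFTURTransfer`, part 5 of the lever of line
`drude-controls-conductance`): the mean, equilibrium variance and δ-continuity of the time-integrated total current
and the pathwise total-heat identity imply the planner's `TotalCurrentFTUR` — Hasegawa–Van Vu on `Obs N` with the odd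
observable `totalHeatObs`, ★'s entropy balance and steady heat rates, transport to `Φ_t`, and
`LinearResponseFTUR.Line.shape_of_hvv_family` on the `(N-1)`-rescaled family. -/
theorem stub_totalCurrentFTURTransfer :
    TimeIntegratedCurrentMean → EquilibriumTimeIntegratedCurrentVariance → TimeIntegratedCurrentVarianceContinuity →
      TotalHeatPathwiseIdentity → TotalCurrentFTUR := by
  intro hM hV hVc hP ω₂ lam β γ hω hl hβ hγ huniq μ hμ T hT D hD C hC N hN _hCont t ht K hK hKL
  -- the landed machinery of ★: entropy balance (from K1 + K3 via (GDB)) and steady heat rates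
  have hEB := LinearResponseFTUR.stub_entropyBalance
    (LinearResponseFTUR.Line.gdb_of_duality_and_girsanov LinearResponseFTUR.stub_pathLebesgueDuality
      LinearResponseFTUR.stub_antiDampedGirsanov)
  have hR := LinearResponseFTUR.stub_steadyHeatRates
  have h2T := LinearResponseFTUR.Line.eventually_temperatures_pos hT
  have hN1 : (0 : ℝ) < (N : ℝ) - 1 := by
    have : (2 : ℝ) ≤ (N : ℝ) := by exact_mod_cast hN
    linarith
  have hA : (N : ℝ) - 1 ≠ 0 := hN1.ne'
  have hA2 : (0 : ℝ) < ((N : ℝ) - 1) ^ 2 := by positivity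
  let i0 : Fin N := ⟨0, by omega⟩
  let iN : Fin N := ⟨N - 1, by omega⟩
  have hi0 : i0.val = 0 := rfl
  have hiN : iN.val = N - 1 := rfl
  have hib : i0.val + 1 < N := by
    show 0 + 1 < N
    omega
  -- the family along `T ± δ/2`
  let μδ : ℝ → Measure (PhaseSpace N) := fun δ => μ N (T + δ / 2) (T - δ / 2)
  let Pf : ℝ → Measure (Obs N) := fun δ =>
    fluxLaw (pinnedChain ω₂ lam β γ) N i0 iN i0 (T + δ / 2) (T - δ / 2) t (μδ δ)
  let φ : Obs N → ℝ := totalHeatObs (pinnedChain ω₂ lam β γ) N i0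
  let Φ : ℝ → PhaseSpace N × WienerPair → ℝ := fun δ =>
    timeIntegratedCurrent (pinnedChain ω₂ lam β γ) N (T + δ / 2) (T - δ / 2) t
  let J : ℝ → ℝ := fun δ => (pinnedChain ω₂ lam β γ).totalCurrent (μδ δ) / ((N : ℝ) - 1)
  let m : ℝ → ℝ := fun δ => t * J δ
  let v : ℝ → ℝ := fun δ => variance (Φ δ) ((μδ δ).prod wienerPair) / ((N : ℝ) - 1) ^ 2
  let s : ℝ → ℝ := fun δ => ∫ p, llr (Pf δ) ((Pf δ).map (flipObs N)) p ∂(Pf δ)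
  have hKLfin : ∀ᶠ δ in 𝓝[≠] (0 : ℝ), InformationTheory.klDiv (μδ δ)
      (Measure.map (fun x : PhaseSpace N => (x.1, -x.2)) (μδ δ)) ≠ ⊤ := by
    filter_upwards [hKL] with δ hδ
    exact ne_top_of_le_ne_top ENNReal.ofReal_ne_top hδ
  -- transport of mean / L² / variance of `φ` under `P_δ` to `Φ_t` under `μ_δ ⊗ W` (part 4)
  have htr : ∀ δ : ℝ, (∫ p, φ p ∂(Pf δ) = ∫ zw, Φ δ zw ∂((μδ δ).prod wienerPair)) ∧
      (MemLp φ 2 (Pf δ) ↔ MemLp (Φ δ) 2 ((μδ δ).prod wienerPair)) ∧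
      variance φ (Pf δ) = variance (Φ δ) ((μδ δ).prod wienerPair) := fun δ =>
    transport hω hl.le hβ.le hγ.le hP N i0 iN hN hi0 hiN (T + δ / 2) (T - δ / 2) t ht.le (μδ δ)
  -- parts 2–3: eventual `L²` and the variance limit, identified at `δ = 0` through the Gibbs member
  obtain ⟨hMem, hvlim⟩ := hVc ω₂ lam β γ hω hl hβ hγ huniq μ hμ T hT N hN t ht
  have hGibbs : μ N T T = (pinnedChain ω₂ lam β γ).gibbsMeasure N T :=
    ness_eq_gibbsMeasure hω hl hβ huniq μ hμ N hT
  obtain ⟨-, hV0eq⟩ := hV ω₂ lam β γ hω hl hβ hγ huniq T hT C hC N hN t ht.le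
  have hvlim' : Tendsto v (𝓝[≠] 0) (𝓝 ((2 * ∫ s in (0 : ℝ)..t, (t - s) * C N s) / ((N : ℝ) - 1) ^ 2)) := by
    have e : variance (timeIntegratedCurrent (pinnedChain ω₂ lam β γ) N T T t) ((μ N T T).prod wienerPair) =
        2 * ∫ s in (0 : ℝ)..t, (t - s) * C N s := by
      rw [hGibbs]
      exact hV0eq
    have h1 := hvlim.div_const (((N : ℝ) - 1) ^ 2)
    rw [e] at h1
    exact h1
  -- the bookkeeping certificate on the rescaled family
  have key : 2 * (D N / ((N : ℝ) - 1)) ^ 2 * t ^ 2 ≤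
      (2 * ∫ s in (0 : ℝ)..t, (t - s) * C N s) / ((N : ℝ) - 1) ^ 2 *
        (D N / ((N : ℝ) - 1) * t / T ^ 2 + K) := by
    refine LinearResponseFTUR.Line.shape_of_hvv_family (m := m) (v := v) (s := s) ht hT ?_ ?_ ?_ hvlim' ?_
    · -- the Hasegawa–Van Vu inequality at each small `δ`, divided by `(N-1)²`
      filter_upwards [h2T, hKLfin, hMem] with δ hδ hfin hmem
      obtain ⟨hprob, hac1, hac2, hllr, -, -, -⟩ :=
        hEB ω₂ lam β γ hω hl hβ hγ huniq N i0 iN i0 hN hi0 hiN (T + δ / 2) (T - δ / 2) hδ.1 hδ.2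
          (μδ δ) (hμ N _ _ hδ.1 hδ.2) hfin t ht
      haveI : IsProbabilityMeasure (Pf δ) := hprob
      obtain ⟨hmeanT, hmemT, hvarT⟩ := htr δ
      have hmem' : MemLp φ 2 (Pf δ) := hmemT.2 hmem
      have hftur := Literature.Probability.Entropy.HasegawaVanVu2019_FTUR_holds (Obs N) (Pf δ)
        (flipObs N) (measurable_flipObs N) (flipObs_involutive N) hac1 hac2 hllr φ hmem'
        (totalHeatObs_flipObs (pinnedChain ω₂ lam β γ) N i0)
      obtain ⟨-, hMean⟩ :=
        hM ω₂ lam β γ hω hl hβ hγ huniq μ hμ N hN (T + δ / 2) (T - δ / 2) hδ.1 hδ.2 t ht.le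
      have hmean : ∫ p, φ p ∂(Pf δ) = ((N : ℝ) - 1) * m δ := by
        refine hmeanT.trans (hMean.trans ?_)
        simp only [m, J, μδ]
        field_simp
      have hvar : variance φ (Pf δ) = ((N : ℝ) - 1) ^ 2 * v δ := by
        rw [hvarT]
        simp only [v]
        field_simp
      rw [hmean, hvar] at hftur
      refine le_of_mul_le_mul_left ?_ hA2
      calc ((N : ℝ) - 1) ^ 2 * m δ ^ 2 = (((N : ℝ) - 1) * m δ) ^ 2 := by ring
        _ ≤ 1 / 2 * (((N : ℝ) - 1) ^ 2 * v δ) * (Real.exp (s δ) - 1) := hftur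
        _ = ((N : ℝ) - 1) ^ 2 * (1 / 2 * v δ * (Real.exp (s δ) - 1)) := by ring
    · exact Eventually.of_forall fun δ => div_nonneg (variance_nonneg _ _) (sq_nonneg _)
    · -- `m δ / δ → G t`, `G = D_N/(N-1)`
      have hlim := ((hD N).const_mul t).div_const ((N : ℝ) - 1)
      have e1 : (fun δ => m δ / δ) = fun δ =>
          t * ((pinnedChain ω₂ lam β γ).totalCurrent (μ N (T + δ / 2) (T - δ / 2)) / δ) /
            ((N : ℝ) - 1) := by
        funext δ
        simp only [m, J, μδ]
        ring
      have e2 : D N / ((N : ℝ) - 1) * t = t * D N / ((N : ℝ) - 1) := by ring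
      rw [e1, e2]
      exact hlim
    · -- the entropy balance: `⟨Σ_t⟩_δ = KL(μ_δ‖Θμ_δ) + t J_δ (1/T_R - 1/T_L) ≤ K δ² + …`
      filter_upwards [h2T, hKLfin, hKL] with δ hδ hfin hKδ
      obtain ⟨-, -, -, -, -, -, hllr_eq⟩ :=
        hEB ω₂ lam β γ hω hl hβ hγ huniq N i0 iN i0 hN hi0 hiN (T + δ / 2) (T - δ / 2) hδ.1 hδ.2
          (μδ δ) (hμ N _ _ hδ.1 hδ.2) hfin t ht
      obtain ⟨hQL, hQR, -, -⟩ :=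
        hR ω₂ lam β γ hω hl hβ hγ huniq N i0 iN i0 hN hi0 hiN hib (T + δ / 2) (T - δ / 2) hδ.1 hδ.2
          (μδ δ) (hμ N _ _ hδ.1 hδ.2) t ht.le
      have hKL' : (InformationTheory.klDiv (μδ δ)
          (Measure.map (fun x : PhaseSpace N => (x.1, -x.2)) (μδ δ))).toReal ≤ K * δ ^ 2 :=
        ENNReal.toReal_le_of_le_ofReal (by positivity) hKδ
      have hs_val : s δ = (InformationTheory.klDiv (μδ δ)
          (Measure.map (fun x : PhaseSpace N => (x.1, -x.2)) (μδ δ))).toReal -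
            t * J δ / (T + δ / 2) - -(t * J δ) / (T - δ / 2) := by
        show ∫ p, llr (Pf δ) ((Pf δ).map (flipObs N)) p ∂(Pf δ) = _
        rw [hllr_eq, hQL, hQR]
      have e3 : m δ / t * (1 / (T - δ / 2) - 1 / (T + δ / 2)) * t =
          t * J δ * (1 / (T - δ / 2) - 1 / (T + δ / 2)) := by
        show t * J δ / t * (1 / (T - δ / 2) - 1 / (T + δ / 2)) * t = _
        field_simp
      have e4 : (InformationTheory.klDiv (μδ δ)
          (Measure.map (fun x : PhaseSpace N => (x.1, -x.2)) (μδ δ))).toReal -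
            t * J δ / (T + δ / 2) - -(t * J δ) / (T - δ / 2) =
          (InformationTheory.klDiv (μδ δ)
            (Measure.map (fun x : PhaseSpace N => (x.1, -x.2)) (μδ δ))).toReal +
            t * J δ * (1 / (T - δ / 2) - 1 / (T + δ / 2)) := by
        ring
      rw [hs_val, e3, e4]
      linarith [hKL']
  -- multiply back by `(N-1)²`
  exact rescale_back hA key

end Summit.AtomisticToContinuum.FouriersLaw.Theorems.NonBallistic

end
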